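import Summits.RiemannHypothesis.RiemannHypothesis.Theorems.TiltedLandingLaw421R3Lens1ArcSignB

/-!
# TiltedLandingLaw421R3 — lens-1 (O6-c, director-rh g24): RUNG 2 of the arc-sign ladder TYPED — `NoAscendingArc` (part C, statements + exact split)

LENS-1 gen-6 module image `rh33346-cover/lens-1/ArcSignC-v1.lean` (landing target `…/Theorems/TiltedLandingLaw421R3Lens1ArcSignC.lean`; single import =
part B `…R3Lens1ArcSignB`; namespace `RhW08.Lens1ArcSign`; 0 `sorry`, no instances / notation; checked BY CHAIN over the ArcSign A/B images until tree).

WHY (memo `rh33346-cover/lens-1/O6b-MULTIARC-MEMO-v1.md` 85f61bb8): cut `a`ʼs upper Jensen semicircle of radius `Im a + δ` (ccw from the right foot)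
at the points where `φ := f^{(j+1)}/f^{(j)}` is REAL.  With `s_0 = sgn φ(right foot)`, `s_i = sgn φ(w_i)`, `s_{m̃+1} = sgn φ(left foot)` and `ε_i = ±1`
the sign of `Im φ` on sub-arc `i`:  (ARC) `2k = Σ_i ε_i (s_i − s_{i+1})` (topological — `log_increment_eq` per sub-arc, conjugation for the lower half),
and with the argument principle and the real Rolle identity (PIN) `ch = 1 + pz − #asc + #desc`: the number of upper zeros of `f^{(j+1)}` in the disc is
one, plus the foreign upper zeros of `f^{(j)}` inside, minus the ASCENDING bad arcs (`Im φ > 0` inside, `φ` from a negative to a positive real value),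
plus the DESCENDING ones.  So the law holds whenever NO BAD ARC IS ASCENDING — for every `m̃` and any number of crossing mates.  That is RUNG 2.

CONTENT: §1 `arcPhi` (φ along the parametrised circle), `NoAscendingArc f j a δ`, `ArcNoAsc f j a` (:= for all small `δ`), ★ `PinningOfNoAscendingArc`
(RUNG 2 as a `Prop`; OPEN this image — its proof is part D: finiteness of the break points + the partition version of `two_mul_wind_eq` + the count),
`noAscendingArc_of_im_neg`, ★ `arcNoAsc_of_arcSignClear` (RUNG 1ʼs hypothesis ⇒ RUNG 2ʼs: no bad arc at all).  §2 the typed residual after RUNG 2,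
`TopPinningAscResidual` (crossing mates, not arc-sign clear, AND an ascending bad arc on arbitrarily small circles) with the exact split
`arcResidual_of_rung2` : `PinningOfNoAscendingArc → TopPinningAscResidual → TopPinningArcResidual`, hence `topPinning_of_rung2`; converse
`ascResidual_of_topPinning`.  Conjecture ASC-PAY (memo §3: every ascending arc is paid by an interior foreign upper zero) is NOT typed here.

HONEST LABEL: statements and bookkeeping only; `PinningOfNoAscendingArc` (RUNG 2), `TopPinningAscResidual`, `TopPinningArcResidual`, `TopPinning`,
`TopPinningCrossing`, `RegUmbrella11S`, 33346, 33347 are OPEN; nothing here bears on the truth of RH; RH is not proved; checked ≠ proved.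
-/

noncomputable section

namespace RhW08.Lens1ArcSign

open Complex Set Metric
open Literature.Topology.PlaneTopology Literature.Analysis.Complex
open Summit.RiemannHypothesis.RiemannHypothesis.Theorems.Splittings.JensenWindow
open RhIdea6.G17.W07C7 RhIdea6.G17.W07C7.Rev6 RhIdea6.G18.W07C8.Law421BirthS RhIdea6.G19.W07C11.Seam
open RhIdea6.G20.W07C12.Frac RhIdea6.G20.W07C12.StColP RhW07.C12.FieldSplit RhIdea6.G21.W07C13.TentMax
open RhW07.C14.TwoSided RhW07.C14.Classes RhW07.C14.Lineage RhW07.C14.Booking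
open RhW07.C13.Heredity RhIdea6.G22.W07C15pre.Injection RhW07.E3.Cell RhW07.E3.Lit
open RhW08.Round1 RhW08.StSwap RhW08.Round2 RhW08.QuadW RhW08.SealSwapQ RhW08.SealSwap RhW08.SuccB RhW08.SuccSplit
open RhW08.SuccTheft RhW08.Column RhW08.Hurwitz RhW08.ClusterQ RhW08.ClusterQM RhW08.NewtonDoor RhW08.NewtonDoorGenusOne RhW08.PurseP
open RhW08.Lens1SignCut RhW08.Lens1Coverage RhW08.IsolatedTilt RhW08.Lens1Pinning RhW08.Lens1PinningIso

/-! ## §1 RUNG 2 typed: no ascending bad arc -/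

/-- `φ = f^{(j+1)}/f^{(j)}` along `a`ʼs Jensen circle of radius `Im a + δ`, parametrised by `…PlaneTopology.circleLoop` (`t ∈ [0, ½]` = the upper
semicircle, counterclockwise from the right foot `t = 0` to the left foot `t = ½`). -/
def arcPhi (f : ℂ → ℂ) (j : ℕ) (a : ℂ) (δ t : ℝ) : ℂ :=
  deriv (iteratedDeriv j f) (circleLoop (a.re : ℂ) (a.im + δ) t) / iteratedDeriv j f (circleLoop (a.re : ℂ) (a.im + δ) t)

/-- NO ASCENDING BAD ARC on the circle of radius `Im a + δ`: on every sub-arc `(t₁, t₂) ⊆ [0, ½]` of the upper semicircle on which `Im φ > 0`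
(a BAD arc) and at whose ends `φ` is real, `φ` does NOT pass from a negative real value (at the earlier end `t₁`) to a positive one (at `t₂`). -/
def NoAscendingArc (f : ℂ → ℂ) (j : ℕ) (a : ℂ) (δ : ℝ) : Prop :=
  ∀ t₁ t₂ : ℝ, 0 ≤ t₁ → t₁ < t₂ → t₂ ≤ 1 / 2 →
    (∀ t ∈ Ioo t₁ t₂, 0 < (arcPhi f j a δ t).im) → (arcPhi f j a δ t₁).im = 0 → (arcPhi f j a δ t₂).im = 0 →
    ¬ ((arcPhi f j a δ t₁).re < 0 ∧ 0 < (arcPhi f j a δ t₂).re)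

/-- `ArcNoAsc f j a`: all small Jensen circles of `a` have no ascending bad arc. -/
def ArcNoAsc (f : ℂ → ℂ) (j : ℕ) (a : ℂ) : Prop :=
  ∃ d0 > 0, ∀ δ ∈ Ioo 0 d0, NoAscendingArc f j a δ

/-- ★ RUNG 2 (STATEMENT; OPEN in this image): on a legal frame, an upper zero `a` of `f^{(j)}` whose small Jensen circles carry no ascending bad arc
satisfies the literal `TopPinning` disjunction.  By (PIN) `ch = 1 + pz − #asc + #desc ≥ 1` this is argument-principle bookkeeping, not a conjecture;
its Lean proof (part D) needs the finiteness of the break points and the partition version of `two_mul_wind_eq`. -/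
def PinningOfNoAscendingArc : Prop :=
  ∀ (η : ℝ) (f : ℂ → ℂ) (x₀ s hmax R Hs : ℝ) (B : ℕ), EngineHyps5 2 η f x₀ s hmax R Hs B → ∀ (j : ℕ) (a : ℂ),
    iteratedDeriv j f a = 0 → 0 < a.im → ArcNoAsc f j a →
    (∃ w : ℂ, iteratedDeriv (j + 1) f w = 0 ∧ w.im ≠ 0 ∧ NestedStep a w) ∨ (∃ x : ℝ, |x - a.re| ≤ a.im ∧ NLEventOf f j x)

/-- No bad arc at all ⇒ no ascending bad arc. -/
theorem noAscendingArc_of_im_neg {f : ℂ → ℂ} {j : ℕ} {a : ℂ} {δ : ℝ} (h : ∀ t ∈ Ioo (0 : ℝ) (1 / 2), (arcPhi f j a δ t).im < 0) :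
    NoAscendingArc f j a δ := by
  intro t₁ t₂ h₁ h12 h₂ hbad _ _ _
  have hmid : (t₁ + t₂) / 2 ∈ Ioo t₁ t₂ := ⟨by linarith, by linarith⟩
  have h0 : (t₁ + t₂) / 2 ∈ Ioo (0 : ℝ) (1 / 2) := ⟨by linarith, by linarith⟩
  exact absurd (hbad _ hmid) (not_lt.mpr (h _ h0).le)

/-- ★ RUNG 1ʼs hypothesis implies RUNG 2ʼs: an arc-sign-clear zero has no bad arc, hence no ascending one. -/
theorem arcNoAsc_of_arcSignClear {f : ℂ → ℂ} {j : ℕ} {a : ℂ} (hapos : 0 < a.im) (hS : ArcSignClear f j a) : ArcNoAsc f j a := by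
  obtain ⟨d0, hd0, hsg⟩ := hS
  refine ⟨d0, hd0, fun δ hδ => noAscendingArc_of_im_neg fun t ht => ?_⟩
  have hr : 0 < a.im + δ := by linarith [hδ.1]
  have hw : ‖circleLoop ((a.re : ℝ) : ℂ) (a.im + δ) t - (a.re : ℂ)‖ = a.im + δ := by
    rw [norm_circleLoop_sub_center, abs_of_pos hr]
  have hwim : 0 < (circleLoop ((a.re : ℝ) : ℂ) (a.im + δ) t).im := by
    rw [circleLoop_ofReal_im]
    refine mul_pos hr (Real.sin_pos_of_pos_of_lt_pi ?_ ?_)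
    · have := ht.1; positivity
    · have h2 := ht.2
      nlinarith [Real.pi_pos]
  exact hsg δ hδ _ hw hwim

/-! ## §2 The typed residual after RUNG 2 and the exact split -/

/-- The ASCENDING residual of the law: `TopPinning` restricted to zeros with crossing mates that are not arc-sign clear AND whose Jensen circles of
arbitrarily small radius excess carry an ascending bad arc (`¬ ArcNoAsc`).  OPEN statement; conjecture ASC-PAY (memo §3) would discharge it. -/
def TopPinningAscResidual : Prop :=
  ∀ (η : ℝ) (f : ℂ → ℂ) (x₀ s hmax R Hs : ℝ) (B : ℕ), EngineHyps5 2 η f x₀ s hmax R Hs B → ∀ (j : ℕ) (a : ℂ),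
    iteratedDeriv j f a = 0 → 0 < a.im → NoTallerToucher f j a → ¬ JensenIsolated f j a → ¬ ArcSignClear f j a → ¬ ArcNoAsc f j a →
    (∃ w : ℂ, iteratedDeriv (j + 1) f w = 0 ∧ w.im ≠ 0 ∧ NestedStep a w) ∨ (∃ x : ℝ, |x - a.re| ≤ a.im ∧ NLEventOf f j x)

/-- ★ EXACT SPLIT: RUNG 2 and the ascending residual give the arc residual. -/
theorem arcResidual_of_rung2 (h2 : PinningOfNoAscendingArc) (h3 : TopPinningAscResidual) : TopPinningArcResidual := by
  intro η f x₀ s hmax R Hs B hE j a ha hapos hN hJ hS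
  by_cases hA : ArcNoAsc f j a
  · exact h2 η f x₀ s hmax R Hs B hE j a ha hapos hA
  · exact h3 η f x₀ s hmax R Hs B hE j a ha hapos hN hJ hS hA

/-- ★ The law from RUNG 2 and the ascending residual. -/
theorem topPinning_of_rung2 (h2 : PinningOfNoAscendingArc) (h3 : TopPinningAscResidual) : TopPinning :=
  topPinning_of_arcResidual (arcResidual_of_rung2 h2 h3)

/-- Converse (bookkeeping): the split is exact. -/
theorem ascResidual_of_topPinning (hP : TopPinning) : TopPinningAscResidual :=
  fun η f x₀ s hmax R Hs B hE j a ha hapos hN _ _ _ => hP η f x₀ s hmax R Hs B hE j a ha hapos hN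

/-- RUNG 2 alone already gives every RUNG-1 instance (no appeal to `pinning_of_arcSignClear`). -/
theorem rung1_of_rung2 (h2 : PinningOfNoAscendingArc) {η : ℝ} {f : ℂ → ℂ} {x₀ s hmax R Hs : ℝ} {B : ℕ}
    (hE : EngineHyps5 2 η f x₀ s hmax R Hs B) {j : ℕ} {a : ℂ} (ha : iteratedDeriv j f a = 0) (hapos : 0 < a.im) (hS : ArcSignClear f j a) :
    (∃ w : ℂ, iteratedDeriv (j + 1) f w = 0 ∧ w.im ≠ 0 ∧ NestedStep a w) ∨ (∃ x : ℝ, |x - a.re| ≤ a.im ∧ NLEventOf f j x) :=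
  h2 η f x₀ s hmax R Hs B hE j a ha hapos (arcNoAsc_of_arcSignClear hapos hS)

end RhW08.Lens1ArcSign
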